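import Summits.BirchSwinnertonDyer.BirchSwinnertonDyer.Theorems.ResidualThetaTransportAtTwoThetaLayerLambdaCongruenceAtTwoDualChainAcyclic
import HarnessLib

/-!
# Crux `ThetaLayerLambdaCongruenceAtTwo` (stmt-BirchSwinnertonDyer-20688, route ResidualThetaTransportAtTwo), line
# `birth` v14 — SD floor, kernel road, Hecke clause of IP, brick HA4 (part 1 of 2) «HERMITE»: cusp functions depend only on the
# cusp, Farey paths telescope, and the Hermite normal form of a positive-determinant integer matrix under left `SL₂(ℤ)`
# (existence AND uniqueness) (lead prover bsd-wall-rtt-p3 g13; `--supports stmt-BirchSwinnertonDyer-20688 --as helper`; closes nothing)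

HONEST FRAMING. Elementary THEOREMS about `2×2` integer matrices and lists of elements of `SL₂(ℤ)`, in the currency of `…ManinChain` /
`…DualChain*` (w2 g8) and of the plan `Cruxes/ThetaLayerLambdaCongruenceAtTwo/Lines/birth-sd2-hecke-adjoint.md` §3 (D), §4 HA4 (w3 g11);
no definition; nothing about any curve or form is asserted; BSD is not proved by any of this.

WHAT (ingredients of the equivariant convex re-expansion `P(C) = v_C⁻¹·P₀(v_C C)` of `…HeckeAdjointConvexReexpansion`).
* §1 `apply_eq_of_col_zero_parallel`: a cusp function (`F(gT) = F g`, `F(−g) = F g`) takes the same value on `k₁, k₂ ∈ SL₂(ℤ)` with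
  parallel first columns (`k₂ = ±k₁Tʲ`); `sum_map_sub_eq_of_isChain`: a list `[f₁, …, f_r]` whose consecutive edges share their vertex
  (`f_i e₁ = f_{i+1} e₀`) telescopes, `Σ (F f − F(fS)) = F f₁ − F(f_r S)`; `isChain_map_mul_left`.
* §2 entries of `TᶜS·f` (the map `z ↦ c − 1/z`) and of `adj(C)·f`; `adjugate_mul_coe_mul`: `adj(C)·(uf) = adj(u⁻¹C)·f` (`u ∈ SL₂(ℤ)`).
* §3 HERMITE NORMAL FORM: for `det C > 0` there is `v ∈ SL₂(ℤ)` with `vC = (a b; 0 d)`, `d > 0`, `0 ≤ b < d` (`exists_sl2_mul_hermite`: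
  Bezout on the first column, a sign, a power of `T`), and `v` is UNIQUE (`sl2_mul_hermite_unique`) — the uniqueness is what makes the
  re-expansion of part 2 `SL₂(ℤ)`-equivariant.

References: [Manin1972] §1.5–1.7, Thm. 1.6 (Manin's trick, cusps as `g∞`); [Shimura1971] §3.3 (upper-triangular representatives of
`SL₂(ℤ)\\{det = n}`); [CremonaAlgorithms1997] §2.2.
-/

set_option autoImplicit false

noncomputable section

-- justification: the `Summit.BirchSwinnertonDyer.BirchSwinnertonDyer.…` path repeats a component (route-file convention)
set_option linter.dupNamespace false

open scoped Classical MatrixGroups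

open CongruenceSubgroup Matrix.SpecialLinearGroup ModularGroup
open Literature.NumberTheory.EllipticCurves.ModularForms

namespace Summit.BirchSwinnertonDyer.BirchSwinnertonDyer.Theorems.ThetaLayerLambdaCongruenceAtTwo

/-! ## §1. Cusp functions depend only on the cusp; Farey paths telescope -/

section CuspFunctions

/-- An element of `SL₂(ℤ)` with vanishing lower-left entry is `±Tʲ` (`j = m₀₀·m₀₁`). [folklore] -/
theorem eq_T_zpow_or_neg_of_apply_one_zero_eq_zero (m : SL(2, ℤ)) (hz : m 1 0 = 0) :
    m = T ^ (m 0 0 * m 0 1) ∨ m = -T ^ (m 0 0 * m 0 1) := by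
  have hdet := Matrix.SpecialLinearGroup.det_coe m
  rw [Matrix.det_fin_two, hz, mul_zero, sub_zero] at hdet
  rcases Int.eq_one_or_neg_one_of_mul_eq_one hdet with h00 | h00
  · have h11 : m 1 1 = 1 := by rw [h00, one_mul] at hdet; exact hdet
    left
    ext i j
    fin_cases i <;> fin_cases j <;> simp [coe_T_zpow, h00, h11, hz]
  · have h11 : m 1 1 = -1 := by rw [h00] at hdet; linarith
    right
    ext i j
    fin_cases i <;> fin_cases j <;> simp [coe_T_zpow, h00, h11, hz]

/-- **A cusp function depends only on the cusp.** If `F(gT) = F g` and `F(−g) = F g` then `F k₁ = F k₂` whenever the first columns of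
`k₁, k₂ ∈ SL₂(ℤ)` are parallel (`k₁∞ = k₂∞`): indeed `k₁⁻¹k₂` fixes `∞`, so `k₂ = ±k₁Tʲ`. [cite: Manin1972, §1.5] -/
theorem apply_eq_of_col_zero_parallel {A : Type} (F : SL(2, ℤ) → A) (hT : ∀ g, F (g * T) = F g) (hneg : ∀ g, F (-g) = F g)
    (k₁ k₂ : SL(2, ℤ)) (hpar : k₁ 0 0 * k₂ 1 0 = k₁ 1 0 * k₂ 0 0) : F k₁ = F k₂ := by
  set m : SL(2, ℤ) := k₁⁻¹ * k₂ with hm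
  have hm10 : m 1 0 = 0 := by
    have e10 : m 1 0 = ((k₁ : Matrix (Fin 2) (Fin 2) ℤ).adjugate * (k₂ : Matrix (Fin 2) (Fin 2) ℤ)) 1 0 := by
      rw [hm, coe_mul, coe_inv]
    rw [e10, Matrix.adjugate_fin_two, Matrix.mul_apply, Fin.sum_univ_two]
    simp only [Matrix.of_apply, Matrix.cons_val', Matrix.cons_val_zero, Matrix.cons_val_one,
      Matrix.empty_val', Matrix.cons_val_fin_one]
    linear_combination hpar
  have hk₂ : k₂ = k₁ * m := by rw [hm, mul_inv_cancel_left]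
  rcases eq_T_zpow_or_neg_of_apply_one_zero_eq_zero m hm10 with h | h
  · rw [hk₂, h, apply_mul_T_zpow_of_apply_mul_T F hT]
  · rw [hk₂, h, mul_neg, hneg, apply_mul_T_zpow_of_apply_mul_T F hT]

/-- **Farey paths telescope over cusp functions.** If consecutive elements of a non-empty list `L = [f₁, …, f_r]` share their vertex
(`f_i e₁ = f_{i+1} e₀`), then `Σ_{f∈L} (F f − F(fS)) = F f₁ − F(f_r S)` for every cusp function `F`. [cite: Manin1972, Thm. 1.6] -/
theorem sum_map_sub_eq_of_isChain {A : Type} [AddCommGroup A] (F : SL(2, ℤ) → A) (hT : ∀ g, F (g * T) = F g)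
    (hneg : ∀ g, F (-g) = F g) (f₁ : SL(2, ℤ)) (L : List SL(2, ℤ))
    (hch : List.IsChain (fun f g : SL(2, ℤ) ↦ f 0 1 = g 0 0 ∧ f 1 1 = g 1 0) (f₁ :: L)) :
    ((f₁ :: L).map fun f ↦ F f - F (f * S)).sum = F f₁ - F ((f₁ :: L).getLast (List.cons_ne_nil f₁ L) * S) := by
  induction L generalizing f₁ with
  | nil => simp
  | cons f₂ L ih =>
    rw [List.isChain_cons_cons] at hch
    obtain ⟨⟨h01, h11⟩, hch'⟩ := hch
    rw [List.map_cons, List.sum_cons, ih f₂ hch', List.getLast_cons (List.cons_ne_nil f₂ L)]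
    -- `F(f₁ S) = F f₂`: the first column of `f₁S` is the second column of `f₁`, i.e. the first column of `f₂`
    have e : F (f₁ * S) = F f₂ := by
      refine apply_eq_of_col_zero_parallel F hT hneg (f₁ * S) f₂ ?_
      rw [(mul_S_apply f₁).1, (mul_S_apply f₁).2.2.1, h01, h11, mul_comm]
    rw [e]
    abel

end CuspFunctions

/-- Left multiplication preserves the «consecutive edges» relation `f e₁ = g e₀`. [folklore] -/
theorem isChain_map_mul_left (u : SL(2, ℤ)) {L : List SL(2, ℤ)}
    (h : List.IsChain (fun f g : SL(2, ℤ) ↦ f 0 1 = g 0 0 ∧ f 1 1 = g 1 0) L) :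
    List.IsChain (fun f g : SL(2, ℤ) ↦ f 0 1 = g 0 0 ∧ f 1 1 = g 1 0) (L.map fun f ↦ u * f) := by
  rw [List.isChain_map]
  refine List.IsChain.imp (fun f g hfg ↦ ?_) h
  obtain ⟨h0, h1⟩ := hfg
  simp only [coe_mul, Matrix.mul_apply, Fin.sum_univ_two, h0, h1, and_self]

/-! ## §2. Entries of `Tᶜ S f` and `adj(C)·f` -/

section Entries

/-- Entries of `Tᶜ S f`: rows `(c f₀ⱼ − f₁ⱼ)` and `(f₀ⱼ)` — the map `z ↦ c − 1/z` sending the path `∞ → y'` to the path `c → c − 1/y'`.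
[folklore] -/
theorem T_zpow_mul_S_mul_apply (c : ℤ) (f : SL(2, ℤ)) (j : Fin 2) :
    (T ^ c * S * f) 0 j = c * f 0 j - f 1 j ∧ (T ^ c * S * f) 1 j = f 0 j := by
  have e : ((T ^ c * S * f : SL(2, ℤ)) : Matrix (Fin 2) (Fin 2) ℤ) = !![c, -1; 1, 0] * (f : Matrix (Fin 2) (Fin 2) ℤ) := by
    rw [coe_mul, coe_mul, coe_T_zpow, coe_S]
    congr 1
    ext i j
    fin_cases i <;> fin_cases j <;> simp [Matrix.mul_apply, Fin.sum_univ_two]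
  have e' : ∀ i, (T ^ c * S * f) i j = (!![c, -1; 1, 0] * (f : Matrix (Fin 2) (Fin 2) ℤ)) i j := fun i ↦ by rw [← e]
  rw [e' 0, e' 1]
  constructor
  · simp [Matrix.mul_apply, Fin.sum_univ_two]; ring
  · simp [Matrix.mul_apply, Fin.sum_univ_two]

/-- Entries of `adj(C)·f` for `C = (a b; c d)`: rows `(d f₀ⱼ − b f₁ⱼ)` and `(a f₁ⱼ − c f₀ⱼ)`. [folklore] -/
theorem adjugate_mul_apply (C f : Matrix (Fin 2) (Fin 2) ℤ) (j : Fin 2) :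
    (C.adjugate * f) 0 j = C 1 1 * f 0 j - C 0 1 * f 1 j ∧ (C.adjugate * f) 1 j = C 0 0 * f 1 j - C 1 0 * f 0 j := by
  rw [Matrix.adjugate_fin_two]
  constructor
  · simp [Matrix.mul_apply, Fin.sum_univ_two]; ring
  · simp [Matrix.mul_apply, Fin.sum_univ_two]; ring

/-- `adj(u) = u⁻¹` on `SL₂(ℤ)`: `adj(C)·(u f) = adj(u⁻¹C)·f` (so `adj(uH)·(uf) = adj(H)·f`) — the one-sidedness condition of part 2 is
`SL₂(ℤ)`-invariant. [folklore] -/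
theorem adjugate_mul_coe_mul (C : Matrix (Fin 2) (Fin 2) ℤ) (u f : SL(2, ℤ)) :
    C.adjugate * ((u * f : SL(2, ℤ)) : Matrix (Fin 2) (Fin 2) ℤ) =
      (((u⁻¹ : SL(2, ℤ)) : Matrix (Fin 2) (Fin 2) ℤ) * C).adjugate * (f : Matrix (Fin 2) (Fin 2) ℤ) := by
  rw [Matrix.adjugate_mul_distrib, ← coe_inv, inv_inv, coe_mul, Matrix.mul_assoc]

end Entries

/-! ## §3. Hermite normal form under left multiplication by `SL₂(ℤ)` -/

section Hermite

/-- **Bezout column reduction.** For an integer matrix `C` with `det C ≠ 0` there is `v ∈ SL₂(ℤ)` with `(vC)₁₀ = 0`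
(`v = (x y; −c/g a/g)` where `g = gcd(a, c) = xa + yc`, `(a, c)` the first column of `C`). [cite: Shimura1971, §3.3] -/
theorem exists_sl2_mul_apply_one_zero_eq_zero (C : Matrix (Fin 2) (Fin 2) ℤ) (hC : C.det ≠ 0) :
    ∃ v : SL(2, ℤ), ((v : Matrix (Fin 2) (Fin 2) ℤ) * C) 1 0 = 0 := by
  set a : ℤ := C 0 0 with ha
  set c : ℤ := C 1 0 with hc
  set g : ℤ := (Int.gcd a c : ℤ) with hg
  have hg0 : g ≠ 0 := by
    intro h0
    rw [hg, Nat.cast_eq_zero, Int.gcd_eq_zero_iff] at h0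
    apply hC
    rw [Matrix.det_fin_two, ← ha, ← hc, h0.1, h0.2, zero_mul, mul_zero, sub_zero]
  obtain ⟨a', ha'⟩ : g ∣ a := Int.gcd_dvd_left a c
  obtain ⟨c', hc'⟩ : g ∣ c := Int.gcd_dvd_right a c
  have hbez : g = a * Int.gcdA a c + c * Int.gcdB a c := Int.gcd_eq_gcd_ab a c
  have hdet : Int.gcdA a c * a' + Int.gcdB a c * c' = 1 := by
    have h1 : g * (Int.gcdA a c * a' + Int.gcdB a c * c') = g * 1 := by
      rw [mul_one]
      conv_rhs => rw [hbez]
      rw [ha', hc']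
      ring
    exact mul_left_cancel₀ hg0 h1
  refine ⟨⟨!![Int.gcdA a c, Int.gcdB a c; -c', a'], ?_⟩, ?_⟩
  · rw [Matrix.det_fin_two_of]
    linear_combination hdet
  · simp only [Matrix.mul_apply, Fin.sum_univ_two]
    simp only [Matrix.of_apply, Matrix.cons_val', Matrix.cons_val_zero, Matrix.cons_val_one,
      Matrix.empty_val', Matrix.cons_val_fin_one]
    rw [← ha, ← hc, ha', hc']
    ring

/-- **Hermite normal form (existence).** For `det C > 0` there is `v ∈ SL₂(ℤ)` with `vC = (a b; 0 d)`, `d > 0`, `0 ≤ b < d`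
(column reduction, a sign, and a power of `T` on the left). [cite: Shimura1971, §3.3] -/
theorem exists_sl2_mul_hermite (C : Matrix (Fin 2) (Fin 2) ℤ) (hC : 0 < C.det) :
    ∃ v : SL(2, ℤ), ((v : Matrix (Fin 2) (Fin 2) ℤ) * C) 1 0 = 0 ∧ 0 < ((v : Matrix (Fin 2) (Fin 2) ℤ) * C) 1 1 ∧
      0 ≤ ((v : Matrix (Fin 2) (Fin 2) ℤ) * C) 0 1 ∧ ((v : Matrix (Fin 2) (Fin 2) ℤ) * C) 0 1 < ((v : Matrix (Fin 2) (Fin 2) ℤ) * C) 1 1 := by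
  obtain ⟨v₀, hv₀⟩ := exists_sl2_mul_apply_one_zero_eq_zero C hC.ne'
  -- fix the sign of the diagonal
  obtain ⟨v₁, hv₁0, hv₁d⟩ : ∃ v₁ : SL(2, ℤ), ((v₁ : Matrix (Fin 2) (Fin 2) ℤ) * C) 1 0 = 0 ∧
      0 < ((v₁ : Matrix (Fin 2) (Fin 2) ℤ) * C) 1 1 := by
    set M := (v₀ : Matrix (Fin 2) (Fin 2) ℤ) * C with hM
    have hdetM : M.det = C.det := by rw [hM, Matrix.det_mul, Matrix.SpecialLinearGroup.det_coe, one_mul]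
    have hd0 : M 1 1 ≠ 0 := by
      intro h0
      rw [Matrix.det_fin_two, hv₀, h0, mul_zero, mul_zero, sub_zero] at hdetM
      exact hC.ne' hdetM.symm
    rcases lt_or_gt_of_ne hd0 with hneg | hpos
    · refine ⟨-v₀, ?_, ?_⟩
      · rw [coe_neg, Matrix.neg_mul, Matrix.neg_apply, ← hM, hv₀, neg_zero]
      · rw [coe_neg, Matrix.neg_mul, Matrix.neg_apply, ← hM]; linarith
    · exact ⟨v₀, hv₀, hpos⟩
  -- reduce the upper-right entry modulo `d` by a power of `T` on the left
  set M := (v₁ : Matrix (Fin 2) (Fin 2) ℤ) * C with hM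
  set k : ℤ := M 0 1 / M 1 1 with hk
  refine ⟨T ^ (-k) * v₁, ?_, ?_, ?_, ?_⟩ <;>
    rw [coe_mul, Matrix.mul_assoc, ← hM, coe_T_zpow]
  · simp [Matrix.mul_apply, Fin.sum_univ_two, hv₁0]
  · simpa [Matrix.mul_apply, Fin.sum_univ_two] using hv₁d
  · have e : (!![(1 : ℤ), -k; 0, 1] * M) 0 1 = M 0 1 % M 1 1 := by
      simp [Matrix.mul_apply, Fin.sum_univ_two, Int.emod_def, hk]; ring
    rw [e]; exact Int.emod_nonneg _ hv₁d.ne'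
  · have e : (!![(1 : ℤ), -k; 0, 1] * M) 0 1 = M 0 1 % M 1 1 := by
      simp [Matrix.mul_apply, Fin.sum_univ_two, Int.emod_def, hk]; ring
    have e' : (!![(1 : ℤ), -k; 0, 1] * M) 1 1 = M 1 1 := by
      simp [Matrix.mul_apply, Fin.sum_univ_two]
    rw [e, e']; exact Int.emod_lt_of_pos _ hv₁d

/-- **Hermite normal form (uniqueness).** If `vC` and `v'C` are both of the form `(a b; 0 d)` with `d > 0`, `0 ≤ b < d` (`det C > 0`),
then `v = v'`: `w = v'v⁻¹` fixes `∞` (so `w = ±Tʲ`), has positive lower-right entry (so `w = Tʲ`), and `j = 0` because both `b`'s are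
reduced. This uniqueness is what makes the re-expansion `P` of part 2 `SL₂(ℤ)`-EQUIVARIANT. [cite: Shimura1971, §3.3] -/
theorem sl2_mul_hermite_unique (C : Matrix (Fin 2) (Fin 2) ℤ) (hC : 0 < C.det) (v v' : SL(2, ℤ))
    (h10 : ((v : Matrix (Fin 2) (Fin 2) ℤ) * C) 1 0 = 0) (hd : 0 < ((v : Matrix (Fin 2) (Fin 2) ℤ) * C) 1 1)
    (hb : 0 ≤ ((v : Matrix (Fin 2) (Fin 2) ℤ) * C) 0 1) (hbd : ((v : Matrix (Fin 2) (Fin 2) ℤ) * C) 0 1 < ((v : Matrix (Fin 2) (Fin 2) ℤ) * C) 1 1)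
    (h10' : ((v' : Matrix (Fin 2) (Fin 2) ℤ) * C) 1 0 = 0) (hd' : 0 < ((v' : Matrix (Fin 2) (Fin 2) ℤ) * C) 1 1)
    (hb' : 0 ≤ ((v' : Matrix (Fin 2) (Fin 2) ℤ) * C) 0 1) (hbd' : ((v' : Matrix (Fin 2) (Fin 2) ℤ) * C) 0 1 < ((v' : Matrix (Fin 2) (Fin 2) ℤ) * C) 1 1) :
    v = v' := by
  set H := (v : Matrix (Fin 2) (Fin 2) ℤ) * C with hH
  set H' := (v' : Matrix (Fin 2) (Fin 2) ℤ) * C with hH'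
  set w : SL(2, ℤ) := v' * v⁻¹ with hw
  have hwH : (w : Matrix (Fin 2) (Fin 2) ℤ) * H = H' := by
    rw [hw, hH, hH', ← Matrix.mul_assoc, ← coe_mul, mul_assoc, inv_mul_cancel, mul_one]
  have hdetH : H.det = C.det := by rw [hH, Matrix.det_mul, Matrix.SpecialLinearGroup.det_coe, one_mul]
  have ha0 : H 0 0 ≠ 0 := by
    intro h0
    rw [Matrix.det_fin_two, h0, h10, zero_mul, mul_zero, sub_zero] at hdetH
    exact hC.ne' hdetH.symm
  -- entries of `wH`
  have e10 : (w : Matrix (Fin 2) (Fin 2) ℤ) 1 0 * H 0 0 = 0 := by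
    have := congrArg (fun X : Matrix (Fin 2) (Fin 2) ℤ ↦ X 1 0) hwH
    simp only [Matrix.mul_apply, Fin.sum_univ_two, h10, mul_zero, add_zero] at this
    rw [this, h10']
  have hw10 : w 1 0 = 0 := (mul_eq_zero.mp e10).resolve_right ha0
  rcases eq_T_zpow_or_neg_of_apply_one_zero_eq_zero w hw10 with hT | hT
  · -- `w = Tʲ`
    set j := w 0 0 * w 0 1 with hj
    have e11 : H' 1 1 = H 1 1 := by
      have := congrArg (fun X : Matrix (Fin 2) (Fin 2) ℤ ↦ X 1 1) hwH
      rw [hT, coe_T_zpow] at this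
      simpa [Matrix.mul_apply, Fin.sum_univ_two] using this.symm
    have e01 : H' 0 1 = H 0 1 + j * H 1 1 := by
      have := congrArg (fun X : Matrix (Fin 2) (Fin 2) ℤ ↦ X 0 1) hwH
      rw [hT, coe_T_zpow] at this
      simp only [Matrix.mul_apply, Fin.sum_univ_two, Matrix.of_apply, Matrix.cons_val', Matrix.cons_val_zero,
        Matrix.cons_val_one, Matrix.empty_val', Matrix.cons_val_fin_one, one_mul] at this
      rw [hj]; linear_combination -this
    have hj0 : j = 0 := by
      rw [e11] at hbd'
      rw [e01] at hb' hbd'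
      rcases lt_trichotomy j 0 with hlt | heq | hgt
      · nlinarith
      · exact heq
      · nlinarith
    have hw1 : w = 1 := by rw [hT, hj0, zpow_zero]
    rw [hw] at hw1
    exact (mul_inv_eq_one.mp hw1).symm
  · -- `w = −Tʲ` is impossible: the lower-right entries of `H, H'` are both positive
    exfalso
    have e11 : H' 1 1 = -H 1 1 := by
      have := congrArg (fun X : Matrix (Fin 2) (Fin 2) ℤ ↦ X 1 1) hwH
      rw [hT, coe_neg, coe_T_zpow] at this
      simpa [Matrix.mul_apply, Fin.sum_univ_two] using this.symm
    linarith

end Hermite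

end Summit.BirchSwinnertonDyer.BirchSwinnertonDyer.Theorems.ThetaLayerLambdaCongruenceAtTwo

end
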